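import Mathlib
import Literature.Analysis.FluidPDE.VectorCalculus
import Literature.Analysis.FluidPDE.TaoEnstrophyLocalisation
import Summits.NavierStokesRegularity.NavierStokesRegularity.Theorems.SlicedKelvinPlanarFluxAPrioriSqrtReg

/-!
# Crux `SlicedKelvin.PlanarFluxAPriori` (stmt-NavierStokesRegularity-15600), line `registered`:
  cubic-decay bookkeeping (helper for the stub `stub_epsFoldLaw`)

The stub `stub_epsFoldLaw` integrates the pointwise ε-fold law over a plane; every function it
integrates is a polynomial in the atoms `v, Dv, ω = curl v, Dω, f = ⟪ω, n⟫, Df, D²f` with bounded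
coefficients (`f/F(f)`, `ε²/F(f)³`, `F(f)`, `F(s) = √(s² + ε²)`), each monomial containing at
least one atom. Under the hypothesis of the stub, `(1 + ‖x‖)³ ‖Dᵏv(x)‖ ≤ C` for `k ≤ 3`, all
atoms decay like `(1 + ‖x‖)⁻³`. This file provides that bookkeeping:

* `decay_iteratedFDeriv_curl`, `decay_iteratedFDeriv_inner_curl` (registered sub-goal
  `decay_inner_curl`): `curl v = curlCLM ∘ Dv` and `⟪curl v, n⟫ = ⟪n, ·⟫ ∘ curl v` inherit the
  decay of `Dv, D²v, D³v` (`‖Dᵏ(l ∘ g)‖ ≤ ‖l‖ ‖Dᵏg‖`, Mathlib's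
  `ContinuousLinearMap.iteratedFDeriv_comp_left`; the landed `norm_iteratedFDeriv_curl_le`,
  `contDiff_curl`, `norm_frame` of `…PlanarFluxAPrioriSqrtReg` are reused, not restated);
* `decay_zero_one_two`: orders `0, 1, 2` spelled with `g`, `fderiv g`, `fderiv (fderiv g)`;
* a small algebra of DECAYING (`∃ K, ∀ x, (1 + ‖x‖)³ ‖q x‖ ≤ K`) and BOUNDED
  (`∃ B, ∀ x, ‖q x‖ ≤ B`) real functions: sums, differences, products, quotients by functions
  bounded below, squares, domination;
* scalar atoms along unit vectors: components `⟪u, e⟫`, gradient entries `⟪a, Du b⟫`, `Dg e`,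
  `D²g a b`.

Mathlib + `Literature.Analysis.FluidPDE.{VectorCalculus, TaoEnstrophyLocalisation}` + the landed
`…PlanarFluxAPrioriSqrtReg`.
-/

noncomputable section

-- Problem = summit for this single-conjunct summit: the duplicate namespace component is deliberate.
set_option linter.dupNamespace false

namespace Summit.NavierStokesRegularity.NavierStokesRegularity.Theorems.SlicedKelvinPlanarFluxAPriori

open Literature.Analysis.FluidPDE
open scoped InnerProductSpace RealInnerProductSpace ContDiff

/-! ### Iterated derivatives through a continuous linear map -/

/-- `‖Dᵏ(l ∘ g)(x)‖ ≤ ‖l‖ ‖Dᵏg(x)‖` for a continuous linear map `l` and a smooth `g`. -/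
theorem norm_iteratedFDeriv_clm_apply_le {F G : Type*} [NormedAddCommGroup F] [NormedSpace ℝ F]
    [NormedAddCommGroup G] [NormedSpace ℝ G] (l : F →L[ℝ] G)
    {g : EuclideanSpace ℝ (Fin 3) → F} (hg : ContDiff ℝ ∞ g) (x : EuclideanSpace ℝ (Fin 3))
    (k : ℕ) : ‖iteratedFDeriv ℝ k (fun z => l (g z)) x‖ ≤ ‖l‖ * ‖iteratedFDeriv ℝ k g x‖ := by
  rw [show (fun z => l (g z)) = l ∘ g from rfl,
    l.iteratedFDeriv_comp_left hg.contDiffAt (i := k) (mod_cast le_top)]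
  exact l.norm_compContinuousMultilinearMap_le _

/-! ### The vorticity and its components inherit the decay of `Dv, D²v, D³v` -/

/-- Decay of `curl v` and its first two derivatives from the decay of `Dv, D²v, D³v`:
`(1 + ‖x‖)³ ‖Dᵏ(curl v)(x)‖ ≤ ‖curlCLM‖ · C` for `k ≤ 2`. -/
theorem decay_iteratedFDeriv_curl {v : EuclideanSpace ℝ (Fin 3) → EuclideanSpace ℝ (Fin 3)}
    (hv : ContDiff ℝ ∞ v) {C : ℝ}
    (hC : ∀ (x : EuclideanSpace ℝ (Fin 3)) (k : ℕ), k ≤ 3 →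
      (1 + ‖x‖) ^ 3 * ‖iteratedFDeriv ℝ k v x‖ ≤ C)
    (x : EuclideanSpace ℝ (Fin 3)) (k : ℕ) (hk : k ≤ 2) :
    (1 + ‖x‖) ^ 3 * ‖iteratedFDeriv ℝ k (curl v) x‖ ≤ ‖curlCLM‖ * C := by
  have h1 : ‖iteratedFDeriv ℝ k (curl v) x‖ ≤ ‖curlCLM‖ * ‖iteratedFDeriv ℝ (k + 1) v x‖ :=
    norm_iteratedFDeriv_curl_le hv k x
  calc (1 + ‖x‖) ^ 3 * ‖iteratedFDeriv ℝ k (curl v) x‖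
      ≤ (1 + ‖x‖) ^ 3 * (‖curlCLM‖ * ‖iteratedFDeriv ℝ (k + 1) v x‖) := by gcongr
    _ = ‖curlCLM‖ * ((1 + ‖x‖) ^ 3 * ‖iteratedFDeriv ℝ (k + 1) v x‖) := by ring
    _ ≤ ‖curlCLM‖ * C := mul_le_mul_of_nonneg_left (hC x (k + 1) (by omega)) (norm_nonneg curlCLM)

/-- Decay of a component `⟪curl v, n⟫` and its first two derivatives:
`(1 + ‖x‖)³ ‖Dᵏ⟪curl v, n⟫(x)‖ ≤ ‖n‖ ‖curlCLM‖ C` for `k ≤ 2`. -/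
theorem decay_iteratedFDeriv_inner_curl {v : EuclideanSpace ℝ (Fin 3) → EuclideanSpace ℝ (Fin 3)}
    (hv : ContDiff ℝ ∞ v) {C : ℝ}
    (hC : ∀ (x : EuclideanSpace ℝ (Fin 3)) (k : ℕ), k ≤ 3 →
      (1 + ‖x‖) ^ 3 * ‖iteratedFDeriv ℝ k v x‖ ≤ C)
    (n x : EuclideanSpace ℝ (Fin 3)) (k : ℕ) (hk : k ≤ 2) :
    (1 + ‖x‖) ^ 3 * ‖iteratedFDeriv ℝ k (fun z => ⟪curl v z, n⟫) x‖ ≤ ‖n‖ * (‖curlCLM‖ * C) := by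
  have hfun : (fun z => ⟪curl v z, n⟫) = fun z => innerSL ℝ n (curl v z) := by
    funext z
    rw [innerSL_apply_apply, real_inner_comm]
  have h1 : ‖iteratedFDeriv ℝ k (fun z => ⟪curl v z, n⟫) x‖ ≤
      ‖n‖ * ‖iteratedFDeriv ℝ k (curl v) x‖ := by
    rw [hfun, ← innerSL_apply_norm ℝ n]
    exact norm_iteratedFDeriv_clm_apply_le (innerSL ℝ n) (SlicedKelvinPlanarFluxAPriori.contDiff_curl hv) x k
  calc (1 + ‖x‖) ^ 3 * ‖iteratedFDeriv ℝ k (fun z => ⟪curl v z, n⟫) x‖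
      ≤ (1 + ‖x‖) ^ 3 * (‖n‖ * ‖iteratedFDeriv ℝ k (curl v) x‖) := by gcongr
    _ = ‖n‖ * ((1 + ‖x‖) ^ 3 * ‖iteratedFDeriv ℝ k (curl v) x‖) := by ring
    _ ≤ ‖n‖ * (‖curlCLM‖ * C) :=
        mul_le_mul_of_nonneg_left (decay_iteratedFDeriv_curl hv hC x k hk) (norm_nonneg _)

/-- **Registered sub-goal `decay_inner_curl` of `stub_epsFoldLaw`.** If the derivatives of orders
`≤ 3` of a smooth field `v` decay like `(1 + ‖x‖)⁻³`, then every component `⟪curl v, n⟫` of its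
vorticity decays like `(1 + ‖x‖)⁻³` together with its first two derivatives (uniform constant). -/
theorem decay_inner_curl : ∀ (v : EuclideanSpace ℝ (Fin 3) → EuclideanSpace ℝ (Fin 3)) (C : ℝ) (n : EuclideanSpace ℝ (Fin 3)), ContDiff ℝ (⊤ : ℕ∞) v → (∀ (x : EuclideanSpace ℝ (Fin 3)) (k : ℕ), k ≤ 3 → (1 + ‖x‖) ^ 3 * ‖iteratedFDeriv ℝ k v x‖ ≤ C) → ∃ K : ℝ, ∀ (x : EuclideanSpace ℝ (Fin 3)) (k : ℕ), k ≤ 2 → (1 + ‖x‖) ^ 3 * ‖iteratedFDeriv ℝ k (fun z => inner ℝ (Literature.Analysis.FluidPDE.curl v z) n) x‖ ≤ K :=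
  fun _v _C n hv hC => ⟨‖n‖ * (‖curlCLM‖ * _C), fun x k hk => decay_iteratedFDeriv_inner_curl hv hC n x k hk⟩

/-! ### From iterated derivatives to `g`, `Dg`, `D²g` -/

/-- Orders `0, 1, 2` of an iterated-derivative decay bound, spelled with `g`, `fderiv g` and
`fderiv (fderiv g)`. -/
theorem decay_zero_one_two {G : Type*} [NormedAddCommGroup G] [NormedSpace ℝ G]
    {g : EuclideanSpace ℝ (Fin 3) → G} {K : ℝ}
    (h : ∀ (x : EuclideanSpace ℝ (Fin 3)) (k : ℕ), k ≤ 2 →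
      (1 + ‖x‖) ^ 3 * ‖iteratedFDeriv ℝ k g x‖ ≤ K) :
    (∀ x, (1 + ‖x‖) ^ 3 * ‖g x‖ ≤ K) ∧ (∀ x, (1 + ‖x‖) ^ 3 * ‖fderiv ℝ g x‖ ≤ K) ∧
      (∀ x, (1 + ‖x‖) ^ 3 * ‖fderiv ℝ (fderiv ℝ g) x‖ ≤ K) := by
  refine ⟨fun x => ?_, fun x => ?_, fun x => ?_⟩
  · simpa [norm_iteratedFDeriv_zero] using h x 0 (by norm_num)
  · have := h x 1 (by norm_num)
    rwa [← norm_iteratedFDeriv_fderiv, norm_iteratedFDeriv_zero] at this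
  · have := h x 2 (by norm_num)
    rwa [← norm_iteratedFDeriv_fderiv, ← norm_iteratedFDeriv_fderiv, norm_iteratedFDeriv_zero]
      at this

/-! ### Bookkeeping: decaying (`∃ K, (1 + ‖x‖)³ ‖q x‖ ≤ K`) and bounded (`∃ B, ‖q x‖ ≤ B`) functions -/

section Bookkeeping

variable {G : Type*} [NormedAddCommGroup G]

/-- A decaying function is bounded (by the same constant). -/
theorem bdd_of_decay {q : EuclideanSpace ℝ (Fin 3) → G}
    (hq : ∃ K : ℝ, ∀ x, (1 + ‖x‖) ^ 3 * ‖q x‖ ≤ K) : ∃ B : ℝ, ∀ x, ‖q x‖ ≤ B := by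
  obtain ⟨K, hK⟩ := hq
  refine ⟨K, fun x => le_trans ?_ (hK x)⟩
  have h1 : (1 : ℝ) ≤ (1 + ‖x‖) ^ 3 := one_le_pow₀ (by simp)
  calc ‖q x‖ = 1 * ‖q x‖ := (one_mul _).symm
    _ ≤ (1 + ‖x‖) ^ 3 * ‖q x‖ := by gcongr

/-- Domination transfers decay. -/
theorem decay_of_norm_le {H : Type*} [NormedAddCommGroup H] {q : EuclideanSpace ℝ (Fin 3) → G}
    {r : EuclideanSpace ℝ (Fin 3) → H} (hle : ∀ x, ‖q x‖ ≤ ‖r x‖)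
    (hr : ∃ K : ℝ, ∀ x, (1 + ‖x‖) ^ 3 * ‖r x‖ ≤ K) :
    ∃ K : ℝ, ∀ x, (1 + ‖x‖) ^ 3 * ‖q x‖ ≤ K := by
  obtain ⟨K, hK⟩ := hr
  exact ⟨K, fun x => le_trans (by gcongr; exact hle x) (hK x)⟩

/-- Sums of decaying functions decay. -/
theorem decay_add {q r : EuclideanSpace ℝ (Fin 3) → ℝ}
    (hq : ∃ K : ℝ, ∀ x, (1 + ‖x‖) ^ 3 * ‖q x‖ ≤ K)
    (hr : ∃ K : ℝ, ∀ x, (1 + ‖x‖) ^ 3 * ‖r x‖ ≤ K) :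
    ∃ K : ℝ, ∀ x, (1 + ‖x‖) ^ 3 * ‖q x + r x‖ ≤ K := by
  obtain ⟨K₁, h₁⟩ := hq
  obtain ⟨K₂, h₂⟩ := hr
  refine ⟨K₁ + K₂, fun x => ?_⟩
  calc (1 + ‖x‖) ^ 3 * ‖q x + r x‖ ≤ (1 + ‖x‖) ^ 3 * (‖q x‖ + ‖r x‖) := by
        gcongr; exact norm_add_le _ _
    _ = (1 + ‖x‖) ^ 3 * ‖q x‖ + (1 + ‖x‖) ^ 3 * ‖r x‖ := by ring
    _ ≤ K₁ + K₂ := add_le_add (h₁ x) (h₂ x)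

/-- Differences of decaying functions decay. -/
theorem decay_sub {q r : EuclideanSpace ℝ (Fin 3) → ℝ}
    (hq : ∃ K : ℝ, ∀ x, (1 + ‖x‖) ^ 3 * ‖q x‖ ≤ K)
    (hr : ∃ K : ℝ, ∀ x, (1 + ‖x‖) ^ 3 * ‖r x‖ ≤ K) :
    ∃ K : ℝ, ∀ x, (1 + ‖x‖) ^ 3 * ‖q x - r x‖ ≤ K := by
  obtain ⟨K₁, h₁⟩ := hq
  obtain ⟨K₂, h₂⟩ := hr
  refine ⟨K₁ + K₂, fun x => ?_⟩
  calc (1 + ‖x‖) ^ 3 * ‖q x - r x‖ ≤ (1 + ‖x‖) ^ 3 * (‖q x‖ + ‖r x‖) := by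
        gcongr; exact norm_sub_le _ _
    _ = (1 + ‖x‖) ^ 3 * ‖q x‖ + (1 + ‖x‖) ^ 3 * ‖r x‖ := by ring
    _ ≤ K₁ + K₂ := add_le_add (h₁ x) (h₂ x)

/-- Decaying times bounded decays. -/
theorem decay_mul_bdd {q r : EuclideanSpace ℝ (Fin 3) → ℝ}
    (hq : ∃ K : ℝ, ∀ x, (1 + ‖x‖) ^ 3 * ‖q x‖ ≤ K) (hr : ∃ B : ℝ, ∀ x, ‖r x‖ ≤ B) :
    ∃ K : ℝ, ∀ x, (1 + ‖x‖) ^ 3 * ‖q x * r x‖ ≤ K := by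
  obtain ⟨K, hK⟩ := hq
  obtain ⟨B, hB⟩ := hr
  have hB0 : 0 ≤ B := (norm_nonneg _).trans (hB 0)
  refine ⟨K * B, fun x => ?_⟩
  calc (1 + ‖x‖) ^ 3 * ‖q x * r x‖ = (1 + ‖x‖) ^ 3 * ‖q x‖ * ‖r x‖ := by rw [norm_mul]; ring
    _ ≤ K * B := mul_le_mul (hK x) (hB x) (norm_nonneg _) ((hK x).trans' (by positivity))

/-- Bounded times decaying decays. -/
theorem bdd_mul_decay {q r : EuclideanSpace ℝ (Fin 3) → ℝ}
    (hq : ∃ B : ℝ, ∀ x, ‖q x‖ ≤ B) (hr : ∃ K : ℝ, ∀ x, (1 + ‖x‖) ^ 3 * ‖r x‖ ≤ K) :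
    ∃ K : ℝ, ∀ x, (1 + ‖x‖) ^ 3 * ‖q x * r x‖ ≤ K := by
  have h := decay_mul_bdd hr hq
  simpa only [mul_comm] using h

/-- Decaying divided by a function bounded away from zero decays. -/
theorem decay_div_of_le {q r : EuclideanSpace ℝ (Fin 3) → ℝ}
    (hq : ∃ K : ℝ, ∀ x, (1 + ‖x‖) ^ 3 * ‖q x‖ ≤ K) {m : ℝ} (hm : 0 < m)
    (hr : ∀ x, m ≤ r x) :
    ∃ K : ℝ, ∀ x, (1 + ‖x‖) ^ 3 * ‖q x / r x‖ ≤ K := by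
  have hinv : ∃ B : ℝ, ∀ x, ‖(r x)⁻¹‖ ≤ B := by
    refine ⟨m⁻¹, fun x => ?_⟩
    have hr0 : 0 < r x := hm.trans_le (hr x)
    rw [Real.norm_eq_abs, abs_inv, abs_of_pos hr0]
    exact inv_anti₀ hm (hr x)
  simpa only [div_eq_mul_inv] using decay_mul_bdd hq hinv

/-- Sums of bounded functions are bounded. -/
theorem bdd_add {q r : EuclideanSpace ℝ (Fin 3) → ℝ}
    (hq : ∃ B : ℝ, ∀ x, ‖q x‖ ≤ B) (hr : ∃ B : ℝ, ∀ x, ‖r x‖ ≤ B) :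
    ∃ B : ℝ, ∀ x, ‖q x + r x‖ ≤ B := by
  obtain ⟨B₁, h₁⟩ := hq
  obtain ⟨B₂, h₂⟩ := hr
  exact ⟨B₁ + B₂, fun x => (norm_add_le _ _).trans (add_le_add (h₁ x) (h₂ x))⟩

/-- Products of bounded functions are bounded. -/
theorem bdd_mul {q r : EuclideanSpace ℝ (Fin 3) → ℝ}
    (hq : ∃ B : ℝ, ∀ x, ‖q x‖ ≤ B) (hr : ∃ B : ℝ, ∀ x, ‖r x‖ ≤ B) :
    ∃ B : ℝ, ∀ x, ‖q x * r x‖ ≤ B := by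
  obtain ⟨B₁, h₁⟩ := hq
  obtain ⟨B₂, h₂⟩ := hr
  have hB0 : 0 ≤ B₁ := (norm_nonneg _).trans (h₁ 0)
  refine ⟨B₁ * B₂, fun x => ?_⟩
  rw [norm_mul]
  exact mul_le_mul (h₁ x) (h₂ x) (norm_nonneg _) hB0

/-- Constants are bounded. -/
theorem bdd_const (a : ℝ) : ∃ B : ℝ, ∀ _x : EuclideanSpace ℝ (Fin 3), ‖a‖ ≤ B := ⟨‖a‖, fun _ => le_rfl⟩

end Bookkeeping

/-! ### Scalar atoms: components and matrix entries are dominated by norms -/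

/-- `|⟪u, e⟫| ≤ ‖u‖` for a unit vector `e`. -/
theorem norm_inner_le_of_norm_eq_one {u e : EuclideanSpace ℝ (Fin 3)} (he : ‖e‖ = 1) :
    ‖⟪u, e⟫‖ ≤ ‖u‖ := by
  simpa [he] using norm_inner_le_norm (𝕜 := ℝ) u e

/-- `|⟪e, L e'⟫| ≤ ‖L‖` for unit vectors `e, e'` and a continuous linear map `L`. -/
theorem norm_inner_apply_le {G : Type*} [NormedAddCommGroup G] [InnerProductSpace ℝ G]
    {e : G} {e' : EuclideanSpace ℝ (Fin 3)} (he : ‖e‖ = 1)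
    (he' : ‖e'‖ = 1) (L : EuclideanSpace ℝ (Fin 3) →L[ℝ] G) : ‖⟪e, L e'⟫‖ ≤ ‖L‖ := by
  calc ‖⟪e, L e'⟫‖ ≤ ‖e‖ * ‖L e'‖ := norm_inner_le_norm (𝕜 := ℝ) _ _
    _ ≤ ‖e‖ * (‖L‖ * ‖e'‖) := by gcongr; exact L.le_opNorm _
    _ = ‖L‖ := by rw [he, he', one_mul, mul_one]

/-- `‖L e‖ ≤ ‖L‖` for a unit vector `e`. -/
theorem norm_apply_le_of_norm_eq_one {G : Type*} [NormedAddCommGroup G] [NormedSpace ℝ G]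
    {e : EuclideanSpace ℝ (Fin 3)} (he : ‖e‖ = 1) (L : EuclideanSpace ℝ (Fin 3) →L[ℝ] G) :
    ‖L e‖ ≤ ‖L‖ := by
  simpa [he] using L.le_opNorm e

/-- `‖L e e'‖ ≤ ‖L‖` for unit vectors `e, e'` and a bilinear `L` (second derivatives). -/
theorem norm_apply_apply_le_of_norm_eq_one {G : Type*} [NormedAddCommGroup G] [NormedSpace ℝ G]
    {e e' : EuclideanSpace ℝ (Fin 3)} (he : ‖e‖ = 1) (he' : ‖e'‖ = 1)
    (L : EuclideanSpace ℝ (Fin 3) →L[ℝ] EuclideanSpace ℝ (Fin 3) →L[ℝ] G) :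
    ‖L e e'‖ ≤ ‖L‖ :=
  (norm_apply_le_of_norm_eq_one he' (L e)).trans (norm_apply_le_of_norm_eq_one he L)

/-! ### Scalar atoms of a decaying field decay -/

/-- Components `⟪u x, e⟫` of a decaying field decay (`e` a unit vector). -/
theorem decay_inner_of_decay {u : EuclideanSpace ℝ (Fin 3) → EuclideanSpace ℝ (Fin 3)} {K : ℝ}
    (hu : ∀ x, (1 + ‖x‖) ^ 3 * ‖u x‖ ≤ K) {e : EuclideanSpace ℝ (Fin 3)} (he : ‖e‖ = 1) :
    ∃ K : ℝ, ∀ x, (1 + ‖x‖) ^ 3 * ‖⟪u x, e⟫‖ ≤ K :=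
  decay_of_norm_le (fun _ => norm_inner_le_of_norm_eq_one he) ⟨K, hu⟩

/-- Entries `⟪a, Du(x) b⟫` of a decaying gradient decay (`a, b` unit vectors). -/
theorem decay_inner_fderiv_of_decay {u : EuclideanSpace ℝ (Fin 3) → EuclideanSpace ℝ (Fin 3)}
    {K : ℝ} (hu : ∀ x, (1 + ‖x‖) ^ 3 * ‖fderiv ℝ u x‖ ≤ K) {a b : EuclideanSpace ℝ (Fin 3)}
    (ha : ‖a‖ = 1) (hb : ‖b‖ = 1) :
    ∃ K : ℝ, ∀ x, (1 + ‖x‖) ^ 3 * ‖⟪a, fderiv ℝ u x b⟫‖ ≤ K :=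
  decay_of_norm_le (r := fun x => fderiv ℝ u x)
    (fun x => norm_inner_apply_le ha hb (fderiv ℝ u x)) ⟨K, hu⟩

/-- Directional derivatives `Dg(x) e` of a scalar with decaying gradient decay. -/
theorem decay_fderiv_apply_of_decay {g : EuclideanSpace ℝ (Fin 3) → ℝ} {K : ℝ}
    (hg : ∀ x, (1 + ‖x‖) ^ 3 * ‖fderiv ℝ g x‖ ≤ K) {e : EuclideanSpace ℝ (Fin 3)} (he : ‖e‖ = 1) :
    ∃ K : ℝ, ∀ x, (1 + ‖x‖) ^ 3 * ‖fderiv ℝ g x e‖ ≤ K :=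
  decay_of_norm_le (r := fun x => fderiv ℝ g x)
    (fun x => norm_apply_le_of_norm_eq_one he (fderiv ℝ g x)) ⟨K, hg⟩

/-- Second directional derivatives `D²g(x)[a][b]` of a scalar with decaying Hessian decay. -/
theorem decay_fderiv_fderiv_apply_of_decay {g : EuclideanSpace ℝ (Fin 3) → ℝ} {K : ℝ}
    (hg : ∀ x, (1 + ‖x‖) ^ 3 * ‖fderiv ℝ (fderiv ℝ g) x‖ ≤ K) {a b : EuclideanSpace ℝ (Fin 3)}
    (ha : ‖a‖ = 1) (hb : ‖b‖ = 1) :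
    ∃ K : ℝ, ∀ x, (1 + ‖x‖) ^ 3 * ‖fderiv ℝ (fderiv ℝ g) x a b‖ ≤ K :=
  decay_of_norm_le (r := fun x => fderiv ℝ (fderiv ℝ g) x)
    (fun x => norm_apply_apply_le_of_norm_eq_one ha hb (fderiv ℝ (fderiv ℝ g) x)) ⟨K, hg⟩

/-- Squares of decaying functions decay. -/
theorem decay_sq {q : EuclideanSpace ℝ (Fin 3) → ℝ}
    (hq : ∃ K : ℝ, ∀ x, (1 + ‖x‖) ^ 3 * ‖q x‖ ≤ K) :
    ∃ K : ℝ, ∀ x, (1 + ‖x‖) ^ 3 * ‖q x ^ 2‖ ≤ K := by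
  simpa only [sq] using decay_mul_bdd hq (bdd_of_decay hq)

end Summit.NavierStokesRegularity.NavierStokesRegularity.Theorems.SlicedKelvinPlanarFluxAPriori

end
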